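import Literature.NumberTheory.Sieve.QuadraticRootsLevelForms
import Literature.NumberTheory.Sieve.QuadraticRootsPrimeModuliDFIReduction
import Mathlib.Data.ZMod.Units
import HarnessLib

/-!
# Level-`q` cosets of a binary quadratic form: DFI's `O(τ(q))` count (DFI 1995 §2, any sign)

Topic `Literature/NumberTheory/Sieve`, continuation of `QuadraticRootsLevelForms.lean` (roots of
`aX² + bX + c (mod n)`, `d ∣ n` ↔ level forms `[A, B, C]`, `q = ad ∣ A`).  When the level forms
are grouped into classes, the forms `R·ξ` in the `SL₂(ℤ)`-class of a fixed form `R` which have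
level `q` are indexed by the left cosets `ξΓ₀(q)` with `q ∣ (R·ξ).a = R(p, r)`, `(p, r)` the
first column of `ξ` (the condition depends only on the coset: `IsLevelCoset`, `dvd_smul_mul_a_iff`).
W. Duke, J. B. Friedlander, H. Iwaniec, Ann. of Math. 141 (1995), p. 428, note after (14): "for
each `z ∈ Λ_{ab}` the number of `τ` in `Γ₀(q)∖Γ₀(a)` with `γ_τ ≡ 0 (mod q)` is bounded by
`O(τ(q))`, the number of divisors of `q`" — stated there without proof, for `Δ < 0`; it is what
makes the bound of Proposition 4 carry the factor `τ(d)` only.  This file PROVES it for every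
form `R = [A, B, C]` with `A ≠ 0` and non-square discriminant (so for both signs of `Δ`, as
needed for Tóth's positive-discriminant theorem as well):

* `RootForms.exists_card_roots_quad_le` — for a quadratic `αX² + βX + γ` with `α ≠ 0` and
  `β² − 4αγ` not a square, `#{u (mod q) : q ∣ αu² + βu + γ} ≤ C τ(q)` for all `q ≥ 1`
  (primitive part irreducible by Gauss's lemma, Hooley's Lemma 4
  `exists_polyRootCountMod_le_mul_pow_card_primeFactors`, `2^{ω(q)} ≤ τ(q)`);
* `RootForms.exists_levelCoset_rep` — **normal form of a level coset**: every coset `ξΓ₀(q)` with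
  `q ∣ R(p, r)` is the coset of a matrix `(u ∗; e ∗)` with `e = gcd(r, q)`, `e ∣ A`,
  `0 ≤ u < q`, `gcd(u, e) = 1` and `q ∣ Au² + Beu + Ce²` (scale `(p, r)` by a unit `α (mod q)`
  with `αr ≡ e`, lifted from `(ℤ/(q/e))ˣ` by `ZMod.unitsMap_surjective`);
* `RootForms.exists_card_levelCosets_le` — **the count**: there is `C = C(R)` with
  `#{ξΓ₀(q) : q ∣ (R·ξ).a} ≤ C τ(q)` for all `q ≥ 1`; and the transversal form
  `RootForms.card_le_of_levelCosets` (any finite set of pairwise `Γ₀(q)`-inequivalent matrices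
  `ξ` with `q ∣ (R·ξ).a` has at most `C τ(q)` elements).

Everything here is proved; no statement of the paper is vendored.

## References

* W. Duke, J. B. Friedlander, H. Iwaniec, Ann. of Math. (2) 141 (1995), 423–441, §2 p. 428 (the
  remark after (14)). [cite: DukeFriedlanderIwaniec1995, §2 p. 428]
* Á. Tóth, *Roots of quadratic congruences*, IMRN 2000, no. 14, 719–739 (positive discriminant;
  cite-only in the store). [cite: Toth2000, main theorem]
* C. Hooley, *On the distribution of the roots of polynomial congruences*, Mathematika 11 (1964),
  Lemma 4 (`ρ_f(k) ≤ C·deg^{ω(k)}`; the tree's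
  `exists_polyRootCountMod_le_mul_pow_card_primeFactors`, whose citation line is followed here).
  [cite: Hooley1964, Lemma 4]
-/

namespace Literature.NumberTheory.Sieve

open scoped BigOperators Polynomial MatrixGroups
open Finset Polynomial
open Literature.NumberTheory.QuadraticFields.Quadratic (BinQF)

namespace RootForms

/-! ### Root counts of a general quadratic with non-square discriminant -/

/-- **`ρ_g(q) ≤ C_g τ(q)`** for `g = αX² + βX + γ ∈ ℤ[X]` with `α ≠ 0` and `Δ = β² − 4αγ` not a
square: `#{u < q : q ∣ g(u)} ≤ C τ(q)` for all `q ≥ 1`.  (`g = cont(g)·g₀` with `g₀` primitive of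
degree `2` without rational roots, hence irreducible in `ℤ[X]`; a root of `g` modulo `q` is a root
of `g₀` modulo `q/(q, cont g)`; Hooley's Lemma 4 `ρ_{g₀}(k) ≤ C 2^{ω(k)}` and `2^{ω(q)} ≤ τ(q)`.)
[cite: Hooley1964, Lemma 4] -/
theorem exists_card_roots_quad_le {α β γ : ℤ} (hα : α ≠ 0) (hΔ : ¬ IsSquare (discrim α β γ)) :
    ∃ C : ℕ, ∀ q : ℕ, 0 < q →
      ((Finset.range q).filter (fun u : ℕ => (q : ℤ) ∣ α * u ^ 2 + β * u + γ)).card ≤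
        C * (Nat.divisors q).card := by
  set F : ℤ[X] := C α * X ^ 2 + C β * X + C γ with hFdef
  have hFdeg : F.natDegree = 2 := natDegree_quadratic hα
  have hF0 : F ≠ 0 := by
    rintro hF
    rw [hF, natDegree_zero] at hFdeg
    exact absurd hFdeg (by norm_num)
  have hcont : F.content ≠ 0 := mt content_eq_zero_iff.mp hF0
  set F₀ : ℤ[X] := F.primPart with hF₀def
  have hFF₀ : F = C F.content * F₀ := F.eq_C_content_mul_primPart
  have hF₀deg : F₀.natDegree = 2 := by rw [hF₀def, natDegree_primPart, hFdeg]
  have hF₀prim : F₀.IsPrimitive := isPrimitive_primPart F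
  -- `F₀` is irreducible: over `ℚ`, `F` has degree 2 and no root (its discriminant is not a square)
  have hFeval : ∀ x : ℚ, (F.map (algebraMap ℤ ℚ)).eval x = α * x ^ 2 + β * x + γ := by
    intro x
    simp only [hFdef, Polynomial.map_add, Polynomial.map_mul, Polynomial.map_pow, map_X,
      Polynomial.map_C, eval_add, eval_mul, eval_C, eval_pow, eval_X]
    simp only [eq_intCast]
  have hFQdeg : (F.map (algebraMap ℤ ℚ)).natDegree = 2 := by
    rw [natDegree_map_eq_of_injective (algebraMap ℤ ℚ).injective_int, hFdeg]
  have hnoroot : ∀ x : ℚ, ¬ (F.map (algebraMap ℤ ℚ)).IsRoot x := by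
    intro x hx
    rw [IsRoot, hFeval] at hx
    have hdisc : ∀ s : ℚ, discrim (α : ℚ) β γ ≠ s ^ 2 := by
      intro s hs
      have hcast : discrim (α : ℚ) β γ = ((discrim α β γ : ℤ) : ℚ) := by
        simp only [discrim]; push_cast; ring
      apply hΔ
      rw [← Rat.isSquare_intCast_iff, ← hcast, hs]
      exact ⟨s, sq s⟩
    exact quadratic_ne_zero_of_discrim_ne_sq hdisc x (by linear_combination hx)
  have hirrFQ : Irreducible (F.map (algebraMap ℤ ℚ)) :=
    irreducible_of_degree_le_three_of_not_isRoot (by rw [hFQdeg]; decide) hnoroot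
  have hirrF₀Q : Irreducible (F₀.map (algebraMap ℤ ℚ)) := by
    have hmap : F.map (algebraMap ℤ ℚ) =
        C (algebraMap ℤ ℚ F.content) * F₀.map (algebraMap ℤ ℚ) := by
      conv_lhs => rw [hFF₀]
      rw [Polynomial.map_mul, map_C]
    rw [hmap] at hirrFQ
    exact (irreducible_isUnit_mul (isUnit_C.mpr (IsUnit.mk0 _
      ((map_ne_zero_iff _ (algebraMap ℤ ℚ).injective_int).mpr hcont)))).1 hirrFQ
  have hirrF₀ : Irreducible F₀ :=
    (IsPrimitive.irreducible_iff_irreducible_map_fraction_map hF₀prim).2 hirrF₀Q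
  -- Hooley's Lemma 4 for `F₀`
  obtain ⟨C₀, -, hL4⟩ :=
    exists_polyRootCountMod_le_mul_pow_card_primeFactors hirrF₀ (by rw [hF₀deg]; norm_num)
  set g : ℕ := F.content.natAbs with hgdef
  have hg0 : g ≠ 0 := Int.natAbs_ne_zero.mpr hcont
  refine ⟨g * C₀, fun n hn => ?_⟩
  have hgc : (g : ℤ) = F.content := by
    rw [hgdef, Int.natCast_natAbs, Int.abs_eq_normalize, normalize_content]
  set d : ℕ := Nat.gcd n g with hddef
  have hd0 : 0 < d := Nat.gcd_pos_of_pos_left _ hn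
  set n₁ : ℕ := n / d with hn₁def
  have hdn₁ : d * n₁ = n := Nat.mul_div_cancel' (Nat.gcd_dvd_left n g)
  have hdle : d ≤ g := Nat.gcd_le_right (m := n) (Nat.pos_of_ne_zero hg0)
  have hn0 : n ≠ 0 := by omega
  have hn₁dvd : n₁ ∣ n := ⟨d, by rw [mul_comm]; exact hdn₁.symm⟩
  -- the roots of `F` are those counted
  have h0 : ((Finset.range n).filter (fun u : ℕ => (n : ℤ) ∣ α * u ^ 2 + β * u + γ)) =
      (Finset.range n).filter (fun ν : ℕ => (n : ℤ) ∣ F.eval (ν : ℤ)) := by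
    refine Finset.filter_congr fun ν _ => ?_
    simp [hFdef]
  rw [h0]
  -- `#{ν < n : n ∣ F(ν)} ≤ #{ν < n : n₁ ∣ F₀(ν)} = d ρ_{F₀}(n₁)`
  have h2 : ((Finset.range n).filter (fun ν : ℕ => (n : ℤ) ∣ F.eval (ν : ℤ))).card ≤
      ((Finset.range n).filter (fun ν : ℕ => (n₁ : ℤ) ∣ F₀.eval (ν : ℤ))).card := by
    refine Finset.card_le_card fun ν hν => ?_
    rw [Finset.mem_filter] at hν ⊢
    refine ⟨hν.1, ?_⟩
    have hev : F.eval (ν : ℤ) = (g : ℤ) * F₀.eval (ν : ℤ) := by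
      conv_lhs => rw [hFF₀]
      rw [eval_mul, eval_C, hgc]
    have := hν.2
    rw [hev] at this
    exact div_gcd_dvd_of_dvd_mul hg0 this
  have h3 : ((Finset.range n).filter (fun ν : ℕ => (n₁ : ℤ) ∣ F₀.eval (ν : ℤ))).card =
      d * polyRootCountMod ![F₀] n₁ := by
    rw [← card_filter_dvd_eval_eq_polyRootCountMod, ← card_filter_range_mul_dvd_eval, hdn₁]
  -- Hooley's Lemma 4 and `2^{ω(n₁)} ≤ 2^{ω(n)} ≤ τ(n)`
  have h4 : polyRootCountMod ![F₀] n₁ ≤ C₀ * 2 ^ n.primeFactors.card := by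
    refine (hL4 n₁).trans ?_
    rw [hF₀deg]
    exact Nat.mul_le_mul_left _ (Nat.pow_le_pow_right (by norm_num)
      (Finset.card_le_card (Nat.primeFactors_mono hn₁dvd hn0)))
  have h5 := GoldbachSeries.two_pow_card_primeFactors_le_card_divisors hn0
  calc ((Finset.range n).filter (fun ν : ℕ => (n : ℤ) ∣ F.eval (ν : ℤ))).card
      ≤ d * polyRootCountMod ![F₀] n₁ := h3 ▸ h2
    _ ≤ g * (C₀ * 2 ^ n.primeFactors.card) := Nat.mul_le_mul hdle h4
    _ ≤ g * (C₀ * (Nat.divisors n).card) :=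
        Nat.mul_le_mul_left _ (Nat.mul_le_mul_left _ h5)
    _ = g * C₀ * (Nat.divisors n).card := by ring

/-! ### Level cosets -/

section cosets

variable {q : ℕ}

/-- `R(tx, ty) = t² R(x, y)`. [folklore] -/
theorem eval_mul_mul (R : BinQF) (t x y : ℤ) : R.eval (t * x) (t * y) = t ^ 2 * R.eval x y := by
  simp only [BinQF.eval]; ring

/-- The first column of `ξγ`, `γ ∈ Γ₀(q)`, is `≡ γ₀₀ · (first column of ξ) (mod q)`, and `γ₀₀` is a
unit modulo `q`; hence **`q ∣ (R·ξγ).a ↔ q ∣ (R·ξ).a`**: the level condition depends only on the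
coset `ξΓ₀(q)`. [cite: DukeFriedlanderIwaniec1995, §2 p. 428] -/
theorem dvd_smul_mul_a_iff (R : BinQF) (ξ : SL(2, ℤ)) {γ : SL(2, ℤ)}
    (hγ : γ ∈ CongruenceSubgroup.Gamma0 q) :
    (q : ℤ) ∣ (smul R (ξ * γ)).a ↔ (q : ℤ) ∣ (smul R ξ).a := by
  rcases Nat.eq_zero_or_pos q with rfl | hq
  · -- `q = 0`: `γ` is upper triangular over `ℤ`... i.e. `γ₁₀ = 0`, and divisibility by `0` is equality
    have h10 : γ 1 0 = 0 := by
      have h := CongruenceSubgroup.Gamma0_mem.1 hγ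
      exact (ZMod.intCast_zmod_eq_zero_iff_dvd _ 0 |>.1 h) |> fun h => by simpa using h
    have hdet : γ 0 0 * γ 1 1 - γ 0 1 * γ 1 0 = 1 := by
      have h := γ.det_coe; rwa [Matrix.det_fin_two] at h
    rw [h10, mul_zero, sub_zero] at hdet
    have hsq : (γ 0 0) ^ 2 = 1 := by
      rcases Int.eq_one_or_neg_one_of_mul_eq_one hdet with h | h <;> simp [h]
    simp only [Nat.cast_zero, zero_dvd_iff, smul_a, Matrix.SpecialLinearGroup.coe_mul,
      Matrix.mul_apply, Fin.sum_univ_two, h10, mul_zero, add_zero]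
    rw [show ξ 0 0 * γ 0 0 = γ 0 0 * ξ 0 0 by ring, show ξ 1 0 * γ 0 0 = γ 0 0 * ξ 1 0 by ring,
      eval_mul_mul, hsq, one_mul]
  haveI : NeZero q := ⟨hq.ne'⟩
  have h10 : ((γ 1 0 : ℤ) : ZMod q) = 0 := CongruenceSubgroup.Gamma0_mem.1 hγ
  have hdet : γ 0 0 * γ 1 1 - γ 0 1 * γ 1 0 = 1 := by
    have h := γ.det_coe; rwa [Matrix.det_fin_two] at h
  have hunit : IsUnit ((γ 0 0 : ℤ) : ZMod q) := by
    refine IsUnit.of_mul_eq_one ((γ 1 1 : ℤ) : ZMod q) ?_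
    have := congrArg (fun z : ℤ => (z : ZMod q)) hdet
    simp only [Int.cast_sub, Int.cast_mul, Int.cast_one, h10, mul_zero, sub_zero] at this
    exact this
  rw [← ZMod.intCast_zmod_eq_zero_iff_dvd, ← ZMod.intCast_zmod_eq_zero_iff_dvd]
  simp only [smul_a, BinQF.eval, Matrix.SpecialLinearGroup.coe_mul, Matrix.mul_apply,
    Fin.sum_univ_two]
  push_cast
  simp only [h10, mul_zero, add_zero]
  have key : (R.a : ZMod q) * ((ξ 0 0 : ℤ) * (γ 0 0 : ℤ) : ZMod q) ^ 2 +
        (R.b : ZMod q) * ((ξ 0 0 : ℤ) * (γ 0 0 : ℤ)) * ((ξ 1 0 : ℤ) * (γ 0 0 : ℤ)) +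
        (R.c : ZMod q) * ((ξ 1 0 : ℤ) * (γ 0 0 : ℤ) : ZMod q) ^ 2 =
      ((γ 0 0 : ℤ) : ZMod q) ^ 2 *
        ((R.a : ZMod q) * ((ξ 0 0 : ℤ) : ZMod q) ^ 2 + (R.b : ZMod q) * (ξ 0 0 : ℤ) * (ξ 1 0 : ℤ) +
          (R.c : ZMod q) * ((ξ 1 0 : ℤ) : ZMod q) ^ 2) := by
    ring
  rw [key]
  exact (hunit.pow 2).mul_right_eq_zero

/-- **Level cosets.**  `IsLevelCoset R q x`: the left coset `x = ξΓ₀(q)` consists of matrices with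
`q ∣ (R·ξ).a = R(p, r)` (`(p, r)` the first column of `ξ`) — the cosets indexing the forms of
level `q` in the class of `R`; DFI's `τ` with `γ_τ ≡ 0 (mod q)`.
[cite: DukeFriedlanderIwaniec1995, §2 p. 428] -/
def IsLevelCoset (R : BinQF) (q : ℕ) (x : SL(2, ℤ) ⧸ CongruenceSubgroup.Gamma0 q) : Prop :=
  ∃ ξ : SL(2, ℤ), (ξ : SL(2, ℤ) ⧸ CongruenceSubgroup.Gamma0 q) = x ∧ (q : ℤ) ∣ (smul R ξ).a

/-- `ξΓ₀(q)` is a level coset iff `q ∣ (R·ξ).a`. [cite: DukeFriedlanderIwaniec1995, §2 p. 428] -/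
theorem isLevelCoset_mk_iff (R : BinQF) (ξ : SL(2, ℤ)) :
    IsLevelCoset R q (ξ : SL(2, ℤ) ⧸ CongruenceSubgroup.Gamma0 q) ↔ (q : ℤ) ∣ (smul R ξ).a := by
  refine ⟨?_, fun h => ⟨ξ, rfl, h⟩⟩
  rintro ⟨ξ', he, h'⟩
  obtain ⟨γ, hγ, rfl⟩ : ∃ γ ∈ CongruenceSubgroup.Gamma0 q, ξ' = ξ * γ := by
    refine ⟨ξ⁻¹ * ξ', QuotientGroup.eq.1 he.symm, by group⟩
  exact (dvd_smul_mul_a_iff R ξ hγ).1 h'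

/-! ### Matrices with a prescribed first column -/

/-- The matrix `(u, −gcdB; e, gcdA) ∈ SL₂(ℤ)` with first column `(u, e)`, `gcd(u, e) = 1`
(Bézout). [folklore] -/
def colMatrix (u e : ℤ) (h : Int.gcd u e = 1) : SL(2, ℤ) :=
  ⟨!![u, -Int.gcdB u e; e, Int.gcdA u e], by
    rw [Matrix.det_fin_two_of]
    have := Int.gcd_eq_gcd_ab u e
    rw [h] at this
    push_cast at this
    linarith⟩

/-- First column of `colMatrix`. [folklore] -/
@[simp] theorem colMatrix_apply_00 (u e : ℤ) (h : Int.gcd u e = 1) : colMatrix u e h 0 0 = u := rfl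

/-- First column of `colMatrix`. [folklore] -/
@[simp] theorem colMatrix_apply_10 (u e : ℤ) (h : Int.gcd u e = 1) : colMatrix u e h 1 0 = e := rfl

/-- Two matrices with first columns `(p, r)`, `(p', r')` lie in the same left `Γ₀(q)`-coset iff
`p r' ≡ r p' (mod q)` (the lower-left entry of `ξ⁻¹ξ'` is `p r' − r p'`). [folklore] -/
theorem mk_eq_mk_iff (ξ ξ' : SL(2, ℤ)) :
    (ξ : SL(2, ℤ) ⧸ CongruenceSubgroup.Gamma0 q) = ξ' ↔
      ((ξ 0 0 * ξ' 1 0 - ξ 1 0 * ξ' 0 0 : ℤ) : ZMod q) = 0 := by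
  rw [QuotientGroup.eq, CongruenceSubgroup.Gamma0_mem]
  have h : (ξ⁻¹ * ξ') 1 0 = ξ 0 0 * ξ' 1 0 - ξ 1 0 * ξ' 0 0 := by
    simp [Matrix.SpecialLinearGroup.coe_inv, Matrix.adjugate_fin_two, Matrix.mul_apply,
      Fin.sum_univ_two]
    ring
  rw [h]

/-! ### The normal form of a level coset -/

/-- **Normal form of a level coset.**  Let `A = R.a`, `q ≥ 1`, `ξ ∈ SL₂(ℤ)` with first column
`(p, r)` and `q ∣ R(p, r)`.  Put `e = gcd(r, q)`.  Then `e ∣ A` (as `e ∣ Ap²`, `(e, p) = 1`), and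
there is `u`, `0 ≤ u < q`, `gcd(u, e) = 1`, with `q ∣ Au² + Beu + Ce²` and
`ξΓ₀(q) = (u ∗; e ∗)Γ₀(q)`: scale `(p, r)` by a unit `α (mod q)` with `α r ≡ e (mod q)` — `α` is a
lift to `(ℤ/q)ˣ` of the inverse of `r/e` in `(ℤ/(q/e))ˣ` — and take `u ≡ αp`.
[cite: DukeFriedlanderIwaniec1995, §2 p. 428 (the count `O(τ(q))`, proof supplied here)] -/
theorem exists_levelCoset_rep (R : BinQF) (hq : 0 < q) (ξ : SL(2, ℤ))
    (hξ : (q : ℤ) ∣ (smul R ξ).a) :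
    ∃ (e u : ℕ) (h : Int.gcd (u : ℤ) (e : ℤ) = 1), e ∣ q ∧ (e : ℤ) ∣ R.a ∧ u < q ∧
      (q : ℤ) ∣ R.a * u ^ 2 + R.b * e * u + R.c * e ^ 2 ∧
      (colMatrix u e h : SL(2, ℤ) ⧸ CongruenceSubgroup.Gamma0 q) = ξ := by
  haveI : NeZero q := ⟨hq.ne'⟩
  set p : ℤ := ξ 0 0 with hp
  set r : ℤ := ξ 1 0 with hr
  have hdet : ξ 0 0 * ξ 1 1 - ξ 0 1 * ξ 1 0 = 1 := by
    have h := ξ.det_coe; rwa [Matrix.det_fin_two] at h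
  have hcop : IsCoprime p r := ⟨ξ 1 1, -(ξ 0 1), by rw [hp, hr]; linear_combination hdet⟩
  -- `e = gcd(r, q)`
  set e : ℕ := Int.gcd r q with he
  have he0 : 0 < e := Int.gcd_pos_iff.2 (Or.inr (by exact_mod_cast hq.ne'))
  have her : (e : ℤ) ∣ r := Int.gcd_dvd_left _ _
  have heqZ : (e : ℤ) ∣ (q : ℤ) := Int.gcd_dvd_right _ _
  have heq : e ∣ q := Int.natCast_dvd_natCast.1 heqZ
  -- `e ∣ A`
  have hRpr : (q : ℤ) ∣ R.a * p ^ 2 + R.b * p * r + R.c * r ^ 2 := by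
    simpa [smul_a, BinQF.eval] using hξ
  have heA : (e : ℤ) ∣ R.a := by
    have h1 : (e : ℤ) ∣ R.a * p ^ 2 + R.b * p * r + R.c * r ^ 2 := heqZ.trans hRpr
    have h2 : (e : ℤ) ∣ R.a * p ^ 2 := by
      have : R.a * p ^ 2 = (R.a * p ^ 2 + R.b * p * r + R.c * r ^ 2) - r * (R.b * p + R.c * r) := by
        ring
      rw [this]
      exact dvd_sub h1 (her.mul_right _)
    have hcep : IsCoprime (e : ℤ) (p ^ 2) :=
      (hcop.symm.of_isCoprime_of_dvd_left her).pow_right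
    exact hcep.dvd_of_dvd_mul_right h2
  -- `r = e r₁`, `q = e q₁`, `gcd(r₁, q₁) = 1`
  set q₁ : ℕ := q / e with hq₁
  set r₁ : ℤ := r / e with hr₁
  have hqe : e * q₁ = q := Nat.mul_div_cancel' heq
  have hre : (e : ℤ) * r₁ = r := Int.mul_ediv_cancel' her
  have hq₁q : q₁ ∣ q := Dvd.intro_left e hqe
  have hgcd1 : Int.gcd r₁ (q₁ : ℤ) = 1 := by
    have h := Int.gcd_div_gcd_div_gcd (i := r) (j := (q : ℤ)) (by rw [← he]; exact he0)
    rw [← he] at h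
    rwa [hr₁, hq₁, Int.natCast_div]
  -- the unit `α (mod q)` with `α r₁ ≡ 1 (mod q₁)`
  have hunit : IsUnit ((r₁ : ℤ) : ZMod q₁) := by
    rw [ZMod.coe_int_isUnit_iff_isCoprime]
    exact (Int.isCoprime_iff_gcd_eq_one.2 hgcd1).symm
  obtain ⟨βu, hβu⟩ := ZMod.unitsMap_surjective hq₁q hunit.unit⁻¹
  set α : ℤ := (((βu : ZMod q).val : ℕ) : ℤ) with hα
  have hαq : ((α : ℤ) : ZMod q) = (βu : ZMod q) := by
    rw [hα, Int.cast_natCast, ZMod.natCast_zmod_val]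
  have hαunit : IsUnit ((α : ℤ) : ZMod q) := by rw [hαq]; exact Units.isUnit βu
  have hαq₁ : ((α : ℤ) : ZMod q₁) * ((r₁ : ℤ) : ZMod q₁) = 1 := by
    have h1 : ((α : ℤ) : ZMod q₁) = ((ZMod.unitsMap hq₁q βu : (ZMod q₁)ˣ) : ZMod q₁) := by
      rw [ZMod.unitsMap_val, ZMod.cast_eq_val, hα, Int.cast_natCast]
    rw [h1, hβu]
    exact Units.inv_mul_of_eq hunit.unit_spec
  -- `α r ≡ e (mod q)`
  have hαr : (((α * r : ℤ) : ZMod q)) = ((e : ℕ) : ZMod q) := by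
    have h1 : ((q₁ : ℕ) : ℤ) ∣ α * r₁ - 1 := by
      rw [← ZMod.intCast_eq_intCast_iff_dvd_sub]
      push_cast
      exact hαq₁.symm
    have h2 : (q : ℤ) ∣ α * r - e := by
      rw [← hqe, ← hre]
      push_cast
      rw [show α * ((e : ℤ) * r₁) - e = (e : ℤ) * (α * r₁ - 1) by ring]
      exact mul_dvd_mul_left _ h1
    rw [show ((e : ℕ) : ZMod q) = ((e : ℤ) : ZMod q) by simp, ZMod.intCast_eq_intCast_iff_dvd_sub]
    simpa [dvd_sub_comm] using h2
  -- `u ≡ α p (mod q)`, `0 ≤ u < q`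
  set u : ℕ := ((α * p : ℤ) : ZMod q).val with hu
  have huq : u < q := ZMod.val_lt _
  have hucast : ((u : ℕ) : ZMod q) = ((α * p : ℤ) : ZMod q) := by
    rw [hu, ZMod.natCast_zmod_val]
  -- `gcd(u, e) = 1`
  have hue : Int.gcd (u : ℤ) (e : ℤ) = 1 := by
    apply Int.isCoprime_iff_gcd_eq_one.1
    have h1 : (q : ℤ) ∣ (u : ℤ) - α * p := by
      rw [← ZMod.intCast_eq_intCast_iff_dvd_sub]
      exact_mod_cast hucast.symm
    obtain ⟨k, hk⟩ := h1
    have hu' : (u : ℤ) = α * p + (e : ℤ) * (q₁ * k) := by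
      rw [← mul_assoc]
      push_cast [← hqe] at hk
      linear_combination hk
    rw [hu']
    refine IsCoprime.add_mul_left_left ?_ _
    refine IsCoprime.mul_left ?_ (hcop.of_isCoprime_of_dvd_right her)
    have : IsCoprime (q : ℤ) α := (ZMod.coe_int_isUnit_iff_isCoprime α q).1 hαunit
    exact (this.of_isCoprime_of_dvd_left heqZ).symm
  refine ⟨e, u, hue, heq, heA, huq, ?_, ?_⟩
  · -- `q ∣ A u² + B e u + C e²`
    rw [← ZMod.intCast_zmod_eq_zero_iff_dvd]
    have h0 : ((R.a * p ^ 2 + R.b * p * r + R.c * r ^ 2 : ℤ) : ZMod q) = 0 :=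
      (ZMod.intCast_zmod_eq_zero_iff_dvd _ _).2 hRpr
    push_cast at h0 hαr hucast ⊢
    rw [hucast, ← hαr]
    linear_combination ((α : ℤ) : ZMod q) ^ 2 * h0
  · -- same coset: the lower-left entry of `ξ⁻¹ (u ∗; e ∗)` is `p e − r u ≡ pαr − rαp = 0`
    rw [mk_eq_mk_iff]
    simp only [colMatrix_apply_00, colMatrix_apply_10]
    push_cast at hαr hucast ⊢
    rw [← hp, ← hr, hucast, ← hαr]
    ring

/-! ### The count -/

/-- The quadratic `Au² + Beu + Ce²` in `u` has discriminant `e²Δ`. [folklore] -/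
theorem discrim_level (R : BinQF) (e : ℤ) :
    discrim R.a (R.b * e) (R.c * e ^ 2) = e ^ 2 * R.disc := by
  simp only [discrim, BinQF.disc]; ring

/-- `e²Δ` is a square only if `Δ` is (`e ≠ 0`). [folklore] -/
theorem not_isSquare_mul_sq {Δ e : ℤ} (he : e ≠ 0) (hΔ : ¬ IsSquare Δ) : ¬ IsSquare (e ^ 2 * Δ) := by
  rintro ⟨s, hs⟩
  apply hΔ
  have hdvd : e ^ 2 ∣ s ^ 2 := ⟨Δ, by rw [sq s]; exact hs.symm⟩
  obtain ⟨t, rfl⟩ := (Int.pow_dvd_pow_iff two_ne_zero).1 hdvd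
  refine ⟨t, ?_⟩
  have : e ^ 2 * Δ = e ^ 2 * (t * t) := by rw [hs]; ring
  exact mul_left_cancel₀ (pow_ne_zero 2 he) this

/-- **DFI's `O(τ(q))` count of level cosets.**  For an integral form `R = [A, B, C]` with `A ≠ 0`
and non-square discriminant there is `C = C(R)` such that for every `q ≥ 1` the number of left
cosets `ξΓ₀(q)` with `q ∣ (R·ξ).a` is at most `C τ(q)`.  (By `exists_levelCoset_rep` every such
coset is `(u ∗; e ∗)Γ₀(q)` with `e ∣ A` and `u (mod q)` a root of `Au² + Beu + Ce²`, a quadratic of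
discriminant `e²Δ`; sum `exists_card_roots_quad_le` over the divisors `e` of `A`.)  This is the
remark after (14) in DFI ("the number of `τ` … with `γ_τ ≡ 0 (mod q)` is bounded by `O(τ(q))`"),
stated there for `Δ < 0` without proof. [cite: DukeFriedlanderIwaniec1995, §2 p. 428] -/
theorem exists_card_levelCosets_le (R : BinQF) (hA : R.a ≠ 0) (hΔ : ¬ IsSquare R.disc) :
    ∃ C : ℕ, ∀ q : ℕ, 0 < q →
      Nat.card {x : SL(2, ℤ) ⧸ CongruenceSubgroup.Gamma0 q // IsLevelCoset R q x} ≤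
        C * (Nat.divisors q).card := by
  -- a constant for each divisor `e` of `A`
  have key : ∀ e : ℕ, e ≠ 0 → ∃ C : ℕ, ∀ q : ℕ, 0 < q →
      ((Finset.range q).filter
        (fun u : ℕ => (q : ℤ) ∣ R.a * u ^ 2 + R.b * e * u + R.c * e ^ 2)).card ≤
        C * (Nat.divisors q).card := by
    intro e he
    have h := exists_card_roots_quad_le (α := R.a) (β := R.b * e) (γ := R.c * e ^ 2) hA
      (by rw [discrim_level]; exact not_isSquare_mul_sq (by exact_mod_cast he) hΔ)
    simpa [mul_assoc] using h
  choose! Cf hCf using key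
  refine ⟨∑ e ∈ Nat.divisors R.a.natAbs, Cf e, fun q hq => ?_⟩
  haveI : NeZero q := ⟨hq.ne'⟩
  classical
  -- the finite set of data `(e, u)`
  set D : Finset (Σ _ : ℕ, ℕ) := (Nat.divisors R.a.natAbs).sigma (fun e =>
    (Finset.range q).filter
      (fun u : ℕ => (q : ℤ) ∣ R.a * u ^ 2 + R.b * e * u + R.c * e ^ 2)) with hD
  -- the map to cosets
  let Ψ : (Σ _ : ℕ, ℕ) → SL(2, ℤ) ⧸ CongruenceSubgroup.Gamma0 q := fun d =>
    if h : Int.gcd (d.2 : ℤ) (d.1 : ℤ) = 1 then (colMatrix d.2 d.1 h : SL(2, ℤ) ⧸ _) else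
      ((1 : SL(2, ℤ)) : SL(2, ℤ) ⧸ _)
  -- every level coset is `Ψ d` for some `d ∈ D`
  have hsurj : ∀ x : SL(2, ℤ) ⧸ CongruenceSubgroup.Gamma0 q, IsLevelCoset R q x →
      ∃ d ∈ D, Ψ d = x := by
    rintro x ⟨ξ, rfl, hξ⟩
    obtain ⟨e, u, h, heq, heA, huq, hroot, hmk⟩ := exists_levelCoset_rep R hq ξ hξ
    refine ⟨⟨e, u⟩, ?_, ?_⟩
    · rw [hD, Finset.mem_sigma, Nat.mem_divisors, Finset.mem_filter, Finset.mem_range]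
      exact ⟨⟨Int.ofNat_dvd_left.1 heA, Int.natAbs_ne_zero.2 hA⟩, huq, by simpa [mul_assoc] using hroot⟩
    · simp only [Ψ, dif_pos h]
      exact hmk
  -- count
  let D' := {d : D // IsLevelCoset R q (Ψ d)}
  let f : D' → {x : SL(2, ℤ) ⧸ CongruenceSubgroup.Gamma0 q // IsLevelCoset R q x} :=
    fun d => ⟨Ψ d.1, d.2⟩
  have hf : Function.Surjective f := by
    rintro ⟨x, hx⟩
    obtain ⟨d, hd, rfl⟩ := hsurj x hx
    exact ⟨⟨⟨d, hd⟩, hx⟩, rfl⟩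
  calc Nat.card {x : SL(2, ℤ) ⧸ CongruenceSubgroup.Gamma0 q // IsLevelCoset R q x}
      ≤ Nat.card D' := Nat.card_le_card_of_surjective f hf
    _ ≤ Nat.card D := Nat.card_le_card_of_injective (fun d : D' => d.1) Subtype.val_injective
    _ = D.card := Nat.card_eq_finsetCard D
    _ = ∑ e ∈ Nat.divisors R.a.natAbs, ((Finset.range q).filter
          (fun u : ℕ => (q : ℤ) ∣ R.a * u ^ 2 + R.b * e * u + R.c * e ^ 2)).card := by
        rw [hD, Finset.card_sigma]
    _ ≤ ∑ e ∈ Nat.divisors R.a.natAbs, Cf e * (Nat.divisors q).card := by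
        refine Finset.sum_le_sum fun e he => hCf e ?_ q hq
        exact (Nat.pos_of_mem_divisors he).ne'
    _ = (∑ e ∈ Nat.divisors R.a.natAbs, Cf e) * (Nat.divisors q).card := by
        rw [Finset.sum_mul]

/-- **Transversal form of the count.**  With `C = C(R)` as above: any finite set of matrices
`ξ ∈ SL₂(ℤ)` with `q ∣ (R·ξ).a`, pairwise in distinct left `Γ₀(q)`-cosets, has at most `C τ(q)`
elements. [cite: DukeFriedlanderIwaniec1995, §2 p. 428] -/
theorem card_le_of_levelCosets (R : BinQF) (hA : R.a ≠ 0) (hΔ : ¬ IsSquare R.disc) :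
    ∃ C : ℕ, ∀ q : ℕ, 0 < q → ∀ T : Finset SL(2, ℤ),
      (∀ ξ ∈ T, (q : ℤ) ∣ (smul R ξ).a) →
      (∀ ξ ∈ T, ∀ ξ' ∈ T, (ξ : SL(2, ℤ) ⧸ CongruenceSubgroup.Gamma0 q) = ξ' → ξ = ξ') →
      T.card ≤ C * (Nat.divisors q).card := by
  obtain ⟨C, hC⟩ := exists_card_levelCosets_le R hA hΔ
  refine ⟨C, fun q hq T hT hinj => le_trans ?_ (hC q hq)⟩
  haveI : NeZero q := ⟨hq.ne'⟩
  let f : T → {x : SL(2, ℤ) ⧸ CongruenceSubgroup.Gamma0 q // IsLevelCoset R q x} :=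
    fun ξ => ⟨(ξ.1 : SL(2, ℤ) ⧸ _), (isLevelCoset_mk_iff R ξ.1).2 (hT ξ.1 ξ.2)⟩
  have hf : Function.Injective f := by
    rintro ⟨ξ, hξ⟩ ⟨ξ', hξ'⟩ h
    have h' := congrArg Subtype.val h
    exact Subtype.ext (hinj ξ hξ ξ' hξ' h')
  rw [← Nat.card_eq_finsetCard T]
  exact Nat.card_le_card_of_injective f hf

end cosets

end RootForms

end Literature.NumberTheory.Sieve
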